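import Mathlib
import Summits.KontsevichZagierPeriods.KontsevichZagierPeriods.Theorems.InverseLandauTateLiftingSimplexHull
import Summits.KontsevichZagierPeriods.KontsevichZagierPeriods.Theorems.InverseLandauTateLiftingAffineChart
import Literature.NumberTheory.Transcendental.MZVSimplexRep

/-!
# `TateLifting` (stmt-KontsevichZagierPeriods-9129), line `Sketch` — stub 56 `PolytopeUnion`:
# polytopes given as sets

A polytope GIVEN AS A SET — the domain of an honest representation `r` written as a finite union
`⋃ i, convexHull ℝ (range (V i))` of closed simplices with affinely independent real-algebraic
vertices `V i : Fin (N + 1) → ℝᴺ` and pairwise null overlaps — is covered, up to a null set, by the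
pairwise almost-disjoint OPEN-SIMPLEX representations `R i := r|_{interior (convexHull ℝ (range (V i)))}`
(same integrand). These are exactly the cover hypotheses consumed by the landed polytope sector
(`kzPeriodConjecture_polytope`, iterated domain additivity, rule (1)).

* `PolytopeUnion.isSemialgebraic_interior_convexHull` — the open simplex is `ℚ`-semialgebraic: by
  `tateLifting_simplexHull` it is the image of the `ℚ`-semialgebraic open ordered simplex
  `KZ.openOrderedSimplex N` under the affine map `x ↦ A x + v₀` with real-algebraic entries, and images
  of semialgebraic sets under semialgebraic maps are semialgebraic (Tarski–Seidenberg,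
  `IsSemialgebraicMapOn.isSemialgebraic_image_holds`).
* `PolytopeUnion.volume_diff_interior` — a convex set minus its interior is Lebesgue-null (it lies in
  the frontier, `Convex.addHaar_frontier`).
* `tateLifting_polytopeUnion` — the registered stub: the cover defect `r.domain \ ⋃ interiors` lies in
  the union of the frontiers (null), and two distinct open simplices meet inside the intersection of
  the closed ones (null by hypothesis).

References: M. Kontsevich, D. Zagier, *Periods* (2001), §1.2 rule (1); J. Bochnak, M. Coste,
M.-F. Roy, *Real Algebraic Geometry* (1998), Prop. 2.2.7.
-/

open MeasureTheory Set
open Literature.NumberTheory.Transcendental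
open Literature.ModelTheory.ExponentialFields (IsSemialgebraic)

namespace Summit.KontsevichZagierPeriods.InverseLandau

namespace PolytopeUnion

/-- The open simplex `interior (convexHull ℝ (range v))` spanned by `N + 1` affinely independent
points of `ℝᴺ` with real-algebraic coordinates is `ℚ`-semialgebraic: it is the image of the open
ordered simplex under a real-algebraic affine map (Tarski–Seidenberg).
[cite: BochnakCosteRoy1998, Prop. 2.2.7] -/
theorem isSemialgebraic_interior_convexHull {N : ℕ} (v : Fin (N + 1) → (Fin N → ℝ))
    (hv : AffineIndependent ℝ v) (halg : ∀ a c, IsAlgebraic ℚ (v a c)) :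
    IsSemialgebraic ℚ (interior (convexHull ℝ (Set.range v))) := by
  obtain ⟨-, hhull⟩ := tateLifting_simplexHull N v hv
  rw [hhull]
  have hA : ∀ i j, IsAlgebraic ℚ
      ((Matrix.of fun i j : Fin N => v j.succ i - v (Fin.castSucc j) i) i j) := fun i j => by
    rw [Matrix.of_apply]
    exact (halg _ _).sub (halg _ _)
  exact IsSemialgebraicMapOn.isSemialgebraic_image_holds
    (AffineEngine.isSemialgebraicMapOn_affine hA (fun i => halg 0 i)
      (KZ.isSemialgebraic_openOrderedSimplex N))
    subset_rfl (KZ.isSemialgebraic_openOrderedSimplex N)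

/-- A convex subset of `ℝᴺ` minus its interior is Lebesgue-null: it lies in the frontier, which is
null for convex sets. [folklore] -/
theorem volume_diff_interior {N : ℕ} {s : Set (Fin N → ℝ)} (hs : Convex ℝ s) :
    volume (s \ interior s) = 0 :=
  measure_mono_null (fun _ hx => show _ ∈ closure s \ interior s from ⟨subset_closure hx.1, hx.2⟩)
    (hs.addHaar_frontier volume)

/-- The open simplex lies in the polytope `⋃ i, convexHull ℝ (range (V i))`. [folklore] -/
theorem interior_convexHull_subset {N k : ℕ} (V : Fin k → Fin (N + 1) → (Fin N → ℝ)) (i : Fin k) :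
    interior (convexHull ℝ (Set.range (V i))) ⊆ ⋃ j, convexHull ℝ (Set.range (V j)) :=
  interior_subset.trans (Set.subset_iUnion (fun j => convexHull ℝ (Set.range (V j))) i)

end PolytopeUnion

/-- **POLYTOPES AS SETS** (stub 56 of line `Sketch`): if the domain of an honest representation `r`
is a finite union of closed simplices `convexHull ℝ (range (V i))` with affinely independent
real-algebraic vertices and null pairwise overlaps, then the restrictions
`R i := r|_{interior (convexHull ℝ (range (V i)))}` are honest representations with the same
integrand which cover `r.domain` up to a null set and are pairwise almost disjoint — the cover
hypotheses of `kzPeriodConjecture_polytope` (domain additivity).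
[cite: KontsevichZagier2001, §1.2 rule (1)] -/
theorem tateLifting_polytopeUnion :
  ∀ (N k : ℕ) (V : Fin k → Fin (N + 1) → (Fin N → ℝ)) (r : KZ.IntegralRep N),
    (∀ i, AffineIndependent ℝ (V i)) → (∀ i a c, IsAlgebraic ℚ (V i a c)) →
    r.domain = ⋃ i, convexHull ℝ (Set.range (V i)) →
    (∀ i j, i ≠ j → volume (convexHull ℝ (Set.range (V i)) ∩ convexHull ℝ (Set.range (V j))) = 0) →
    ∃ R : Fin k → KZ.IntegralRep N,
      (∀ i, (R i).domain = interior (convexHull ℝ (Set.range (V i)))) ∧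
      (∀ i, (R i).integrand = r.integrand) ∧
      volume (r.domain \ ⋃ i ∈ (Finset.univ : Finset (Fin k)), (R i).domain) = 0 ∧
      ((Finset.univ : Finset (Fin k)) : Set (Fin k)).Pairwise
        (fun i j => volume ((R i).domain ∩ (R j).domain) = 0) := by
  intro N k V r hV halg hdom hnull
  have hsa : ∀ i, IsSemialgebraic ℚ (interior (convexHull ℝ (Set.range (V i)))) := fun i =>
    PolytopeUnion.isSemialgebraic_interior_convexHull (V i) (hV i) (halg i)
  have hsub : ∀ i, interior (convexHull ℝ (Set.range (V i))) ⊆ r.domain := fun i => by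
    rw [hdom]
    exact PolytopeUnion.interior_convexHull_subset V i
  refine ⟨fun i => r.restrict _ (hsa i) (hsub i), fun i => rfl, fun i => rfl, ?_, ?_⟩
  · -- the cover defect lies in the union of the (null) frontiers of the closed simplices
    refine measure_mono_null (fun x hx => ?_)
      (measure_iUnion_null fun i : Fin k =>
        PolytopeUnion.volume_diff_interior (convex_convexHull ℝ (Set.range (V i))))
    obtain ⟨hx1, hx2⟩ := hx
    rw [hdom, Set.mem_iUnion] at hx1
    obtain ⟨i, hi⟩ := hx1
    exact Set.mem_iUnion.mpr ⟨i, hi, fun hxi => hx2 (Set.mem_iUnion₂.mpr ⟨i, Finset.mem_univ i, hxi⟩)⟩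
  · -- two distinct open simplices meet inside the (null) intersection of the closed ones
    intro i _ j _ hij
    exact measure_mono_null (Set.inter_subset_inter interior_subset interior_subset) (hnull i j hij)

end Summit.KontsevichZagierPeriods.InverseLandau
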